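import Summits.BirchSwinnertonDyer.BirchSwinnertonDyer.Theorems.ErratumRoadFiveEulerHalfGenusLabelsSupply
import HarnessLib

/-!
# ErratumRoadFive ∕ EulerHalf ∕ genus line — (b2b-L♭) THE GENUS LABELS AT A GENERAL LEVEL GUARD and OFF `2N_W` ON EVERY
# PRESENTATION, `2` inert or not (helper, `--supports 23444`; part 1 of 2 — part 2 `…GenusLabelsOddSupply` does the bridges)

Cell bsd-stepL, prover seat `bsd-stepL-imc-p1` g42 (idle hand on the genus line's open asks (R1)/(R2) of line owner bsd-idea-9 g26,
STATUS 2026-08-29T15:04:48Z; both were in-place mutations of landed definitions — `FrameProfile.d8`, the guard of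
`GenusLabelsSupply` — and are refused by the gate as `theorems.append-only`).  Sequel of `…GenusLabels` (p726922),
`…GenusLabelsSupply` (p727943) and Defs III″ (`…GenusClassDefs` §§5–6, p728234).

WHAT.
* `genusLabelsAt_of_facts_level` — p726922's `genusLabelsAt_of_facts` with a GENERAL level guard `N'`, `N_W ∣ N'`: the labels
  `ShimuraWalk.LabelsAt W N' K ι P Y ε` ((B4)/(B5) at the square-free levels prime to `N'` with inert prime factors) and the `±`
  identification, with `h2` asked only off `N'`.  Proof VERBATIM loc. cit. (one line changed: `ℓ ∤ N_W` is read off `ℓ ∤ N'`).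
* `genusLabelsAt_of_facts_odd` — the case `N' = 2N_W`: NO `h2` (an inert prime off `2N_W` is odd), i.e. the labels at the ODD
  admissible levels on EVERY presentation, `2` inert in `K` or not.
* `genusLabelsSupplyOddAt_of_presentation` ∕ `genusLabelsSupplyOddAt_of_printedFacts` ∕ **`genusLabelsSupplyOdd_of_printedFacts`** —
  p727943's two bridges re-run on `_odd`: the consumer-shaped supply `GenusLine.GenusLabelsSupplyOddAt W A p q K S` on every genus
  setting, and the line's Defs III″ input `GenusLine.GenusLabelsSupplyOdd` (∀ frames with the served `FrameProfile`), from the three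
  printed facts ALONE — no `d_K % 8` hypothesis, no `FrameProfile.d8`.  Why this suffices for the class-data child (b2b-κ): its levels
  are square-free products of Zhang Kolyvagin primes, odd for `p ≠ 3` (`GenusLine.ne_two_of_isKolyvaginPrime`,
  `GenusLine.not_dvd_two_mul_of_isKolyvaginPrime`, Defs III″ §5), hence inside the `2N_W` guard.

HONEST FRAMING: conditional on the three named printed facts (G1) `phi_heegnerPointOfConductor_mem_range_map_ringClassField_birch`,
(B5) `Nekovar2007.cmPoint_frobeniusCongruence`, (B3) `GrossLMS1991.prop53_conj_pinned_birch` (hypotheses, as in p726922/p727943);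
no crux and no stub is closed; `EulerHalfPOnlyMultPotMultTwinAtFive` is not proved; BSD is proved for no curve.
[cite: GrossLMS1991, §3 Prop. 3.7, §5 Prop. 5.3] [cite: Nekovar2007, Prop. 4.9] [cite: Darmon2004, Thm. 3.6] [cite: Cox2013, §5.B Prop. 5.16]
presearch: in-tree only (p726922, p727943, p728234); no new literature.
-/

noncomputable section

open scoped Classical ComplexConjugate

set_option linter.dupNamespace false
set_option autoImplicit false

namespace Summit.BirchSwinnertonDyer.BirchSwinnertonDyer.Theorems.GenusLine

open WeierstrassCurve NumberField Field IsDedekindDomain Literature.NumberTheory.EllipticCurves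
  Literature.NumberTheory.EllipticCurves.ModularForms
  Summit.BirchSwinnertonDyer.Rank1Residual.X11b
  Summit.BirchSwinnertonDyer.BirchSwinnertonDyer.Theorems.GenusKolyvagin

variable {K : Type} [Field K] [NumberField K]

/-! ## §1 The labels at a general level guard `N'` (p726922 verbatim, one line generalised) -/

/-- **THE GENUS FAMILY CARRIES `W`'s OWN LABELS AT A GENERAL LEVEL GUARD `N'`** (`N_W ∣ N'`): VERBATIM
`GenusLine.genusLabelsAt_of_facts` (line owner bsd-idea-9 g26, p726922) with the (B4)/(B5) level condition «every prime factor
inert and prime to `N_W`» replaced by «… prime to `N'`» and the hypothesis `h2` asked only OFF `N'` — so that at `N' = 2N_W`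
it disappears (`genusLabelsAt_of_facts_odd`).  Proof = loc. cit. §§0–10 byte-for-byte except the one line reading `ℓ ∤ N_W`
off `ℓ ∤ N'`. [cite: GrossLMS1991, §3 Prop. 3.7, §5 Prop. 5.3] [cite: Nekovar2007, Prop. 4.9] [cite: Darmon2004, Thm. 3.6] -/
theorem genusLabelsAt_of_facts_level
    (hG1 : ∀ (N : ℕ) [NeZero N] (W : WeierstrassCurve ℚ) (K : Type) [Field K] [NumberField K],
      phi_heegnerPointOfConductor_mem_range_map_ringClassField_birch N W K)
    (hNek : Nekovar2007.cmPoint_frobeniusCongruence)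
    (hP53 : ∀ (N : ℕ) [NeZero N] (W : WeierstrassCurve ℚ) (K : Type) [Field K] [NumberField K],
      GrossLMS1991.prop53_conj_pinned_birch N W K)
    (hK : IsImaginaryQuadratic K) (hD4 : NumberField.discr K < -4) (ι : K →+* ℂ)
    (E' : WeierstrassCurve ℚ) [E'.IsElliptic] [E'.IsGloballyMinimal] [NeZero (E'.conductorNorm ℤ)]
    (D C₂ : VariableChange ℚ) [(D • E').IsCharNeTwoNF] (d₁ : ℤ)
    [(C₂ • (D • E').quadraticTwist (d₁ : ℚ)).IsElliptic] [(C₂ • (D • E').quadraticTwist (d₁ : ℚ)).IsGloballyMinimal]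
    (hE' : ∃ C : VariableChange ℚ, C • (C₂ • (D • E').quadraticTwist (d₁ : ℚ)).quadraticTwist (d₁ : ℚ) = E')
    (hd₁ : d₁ ∣ NumberField.discr K)
    (Dt : ModularParametrizationData E' (E'.conductorNorm ℤ)) {β : ℤ}
    (hβ : (4 * (E'.conductorNorm ℤ : ℤ)) ∣ β ^ 2 - NumberField.discr K)
    {θ : ringClassField K ι 1} (hθ2 : θ ^ 2 = algebraMap ℚ (ringClassField K ι 1) (d₁ : ℚ)) (hθ0 : θ ≠ 0)
    (s : ringClassGal ι 1 → ℤˣ)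
    (hθσ : ∀ σ : ringClassGal ι 1, σ.1 θ = ((s σ : ℤ) : ringClassField K ι 1) * θ)
    {y : (E'.baseChange (ringClassField K ι 1)).toAffine.Point}
    (hy : Affine.Point.map (ringClassField K ι 1).subtype.toRatAlgHom y =
      heegnerPointComplexOfConductor Dt (NumberField.discr K) β 1)
    {instF : Fintype (ringClassGal ι 1)}
    {P : ((C₂ • (D • E').quadraticTwist (d₁ : ℚ)).baseChange K).toAffine.Point}
    (hP : Affine.Point.map (algebraMap K (ringClassField K ι 1)).toRatAlgHom P =
      (VariableChange.pointEquivBaseChange ((D • E').quadraticTwist (d₁ : ℚ)) C₂ (ringClassField K ι 1)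
          ((VariableChange.pointEquiv (((D • E').quadraticTwist (d₁ : ℚ)).baseChange (ringClassField K ι 1)) (untwistAt hθ0)).symm
            ((Affine.Point.congrEquiv (untwistAt_smul_eq (D • E') hθ2 hθ0)).symm
              (VariableChange.pointEquivBaseChange E' D (ringClassField K ι 1) (∑ τ : ringClassGal ι 1, (s τ : ℤ) • pointGalHom E' (ringClassField K ι 1) τ.1 y))))))
    {N' : ℕ} (hN' : (C₂ • (D • E').quadraticTwist (d₁ : ℚ)).conductorNorm ℤ ∣ N')
    (h2' : ∀ ℓ : ℕ, ℓ.Prime → (Ideal.span {(ℓ : 𝓞 K)}).IsPrime → ¬ ℓ ∣ N' → ℓ ≠ 2) :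
    ∃ (ys : (m : ℕ) → ((C₂ • (D • E').quadraticTwist (d₁ : ℚ)).baseChange (ringClassField K ι m)).toAffine.Point) (ε : ℤ),
      ShimuraWalk.LabelsAt (C₂ • (D • E').quadraticTwist (d₁ : ℚ)) N' K ι P ys ε ∧
      ∀ (c : ℕ) (hc : c ≠ 0), c.Coprime (E'.conductorNorm ℤ) →
        ∀ {ϑ' : ringClassField K ι c} (hϑ'2 : ϑ' ^ 2 = algebraMap ℚ (ringClassField K ι c) (d₁ : ℚ)) (hϑ'0 : ϑ' ≠ 0)
          {y' : (E'.baseChange (ringClassField K ι c)).toAffine.Point},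
          Affine.Point.map (ringClassField K ι c).subtype.toRatAlgHom y' =
            heegnerPointComplexOfConductor Dt (NumberField.discr K) β c →
          VariableChange.pointEquivBaseChange ((D • E').quadraticTwist (d₁ : ℚ)) C₂ (ringClassField K ι c)
              ((VariableChange.pointEquiv (((D • E').quadraticTwist (d₁ : ℚ)).baseChange (ringClassField K ι c)) (untwistAt hϑ'0)).symm
                ((Affine.Point.congrEquiv (untwistAt_smul_eq (D • E') hϑ'2 hϑ'0)).symm
                  (VariableChange.pointEquivBaseChange E' D (ringClassField K ι c) y'))) = ys c ∨
          VariableChange.pointEquivBaseChange ((D • E').quadraticTwist (d₁ : ℚ)) C₂ (ringClassField K ι c)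
              ((VariableChange.pointEquiv (((D • E').quadraticTwist (d₁ : ℚ)).baseChange (ringClassField K ι c)) (untwistAt hϑ'0)).symm
                ((Affine.Point.congrEquiv (untwistAt_smul_eq (D • E') hϑ'2 hϑ'0)).symm
                  (VariableChange.pointEquivBaseChange E' D (ringClassField K ι c) y'))) = - ys c := by
  -- §0 basic data
  haveI : NeZero ((C₂ • (D • E').quadraticTwist (d₁ : ℚ)).conductorNorm ℤ) :=
    ⟨(WeierstrassCurve.conductorNorm_pos_holds _).ne'⟩
  have hd10 : d₁ ≠ 0 := by
    rintro rfl
    apply hθ0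
    have : θ ^ 2 = 0 := by rw [hθ2]; simp
    exact pow_eq_zero_iff (n := 2) (by norm_num) |>.mp this
  -- §1 the `E′` points over `x(m)` (named fact G1) — `0` off the coprime levels
  have hex : ∀ m : ℕ, m ≠ 0 → m.Coprime (E'.conductorNorm ℤ) →
      ∃ Q : (E'.baseChange (ringClassField K ι m)).toAffine.Point,
        Affine.Point.map (ringClassField K ι m).subtype.toRatAlgHom Q =
          heegnerPointComplexOfConductor Dt (NumberField.discr K) β m :=
    fun m hm hmN => hG1 (E'.conductorNorm ℤ) E' K hK Dt β ι m hβ hm hmN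
  obtain ⟨yE, hyEdef⟩ : ∃ yE : (m : ℕ) → (E'.baseChange (ringClassField K ι m)).toAffine.Point, ∀ m,
      yE m = if h : m ≠ 0 ∧ m.Coprime (E'.conductorNorm ℤ) then (hex m h.1 h.2).choose else 0 :=
    ⟨fun m => if h : m ≠ 0 ∧ m.Coprime (E'.conductorNorm ℤ) then (hex m h.1 h.2).choose else 0, fun _ => rfl⟩
  have hyE : ∀ m (hm : m ≠ 0) (hmN : m.Coprime (E'.conductorNorm ℤ)),
      Affine.Point.map (ringClassField K ι m).subtype.toRatAlgHom (yE m) =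
        heegnerPointComplexOfConductor Dt (NumberField.discr K) β m := by
    intro m hm hmN
    rw [hyEdef m, dif_pos (And.intro hm hmN)]
    exact (hex m hm hmN).choose_spec
  have hyE0 : ∀ m, ¬ (m ≠ 0 ∧ m.Coprime (E'.conductorNorm ℤ)) → yE m = 0 := fun m h => by
    rw [hyEdef m, dif_neg h]
  -- §2 the pin of Prop. 5.3 and the sign `ε`
  obtain ⟨σ₁, hσ₁, H53⟩ := hP53 (E'.conductorNorm ℤ) E' K hK Dt β ι hβ
  set u₁ : ℤ := (s ⟨σ₁, hσ₁⟩ : ℤ) with hu₁def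
  have hu₁ : u₁ = 1 ∨ u₁ = -1 := by
    rcases Int.units_eq_one_or (s ⟨σ₁, hσ₁⟩) with h | h
    · left; rw [hu₁def, h]; rfl
    · right; rw [hu₁def, h]; rfl
  have hσ₁θ : σ₁ θ = ((u₁ : ℤ) : ringClassField K ι 1) * θ := hθσ ⟨σ₁, hσ₁⟩
  set uτ : ℤ := Int.sign d₁ with huτdef
  have huτ : uτ = 1 ∨ uτ = -1 := by
    rcases lt_or_gt_of_ne hd10 with h | h
    · right; exact Int.sign_eq_neg_one_of_neg h
    · left; exact Int.sign_eq_one_of_pos h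
  set ε : ℤ := -E'.rootNumber * uτ * u₁ with hεdef
  have hε : ε = 1 ∨ ε = -1 := by
    rcases WeierstrassCurve.rootNumber_eq_one_or E' with h1 | h1 <;> rcases huτ with h2 | h2 <;>
      rcases hu₁ with h3 | h3 <;> simp [hεdef, h1, h2, h3]
  -- §3 the roots `ϑ_m = χ(m)·θ↑`
  have h1m : ∀ m : ℕ, m ≠ 0 → ringClassField K ι 1 ≤ ringClassField K ι m :=
    fun m hm => ringClassField_mono hK ι (one_dvd m) hm
  obtain ⟨χ, hχdef⟩ : ∃ χ : ℕ → ℤ, ∀ m, χ m = if jacobiSym d₁ m = -1 then -1 else 1 := ⟨_, fun _ => rfl⟩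
  have hχ : ∀ m, χ m = 1 ∨ χ m = -1 := fun m => by rw [hχdef]; exact levelSign_eq_one_or d₁ m
  obtain ⟨ϑ, hϑdef⟩ : ∃ ϑ : (m : ℕ) → m ≠ 0 → ringClassField K ι m, ∀ m (hm : m ≠ 0),
      ϑ m hm = ((χ m : ℤ) : ringClassField K ι m) * RingClassField.inclusion ι (h1m m hm) θ :=
    ⟨fun m hm => ((χ m : ℤ) : ringClassField K ι m) * RingClassField.inclusion ι (h1m m hm) θ, fun _ _ => rfl⟩
  have hϑ2 : ∀ m (hm : m ≠ 0), ϑ m hm ^ 2 = algebraMap ℚ (ringClassField K ι m) (d₁ : ℚ) :=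
    fun m hm => root_sq_eq ι (h1m m hm) (hχ m) hθ2 (hϑdef m hm)
  have hϑ0 : ∀ m (hm : m ≠ 0), ϑ m hm ≠ 0 := fun m hm => root_ne_zero ι (h1m m hm) (hχ m) hθ0 (hϑdef m hm)
  have hϑC : ∀ m (hm : m ≠ 0), (ϑ m hm : ℂ) = ((χ m : ℤ) : ℂ) * (θ : ℂ) :=
    fun m hm => coe_root ι (h1m m hm) (hϑdef m hm)
  -- §4 the bare family
  obtain ⟨Y, hYdef⟩ : ∃ Y : (m : ℕ) → ((C₂ • (D • E').quadraticTwist (d₁ : ℚ)).baseChange (ringClassField K ι m)).toAffine.Point,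
      ∀ m, Y m = if hm : m ≠ 0 then (VariableChange.pointEquivBaseChange ((D • E').quadraticTwist (d₁ : ℚ)) C₂ (ringClassField K ι m)
          ((VariableChange.pointEquiv (((D • E').quadraticTwist (d₁ : ℚ)).baseChange (ringClassField K ι m)) (untwistAt (hϑ0 m hm))).symm
            ((Affine.Point.congrEquiv (untwistAt_smul_eq (D • E') (hϑ2 m hm) (hϑ0 m hm))).symm
              (VariableChange.pointEquivBaseChange E' D (ringClassField K ι m) (yE m))))) else 0 :=
    ⟨fun m => if hm : m ≠ 0 then (VariableChange.pointEquivBaseChange ((D • E').quadraticTwist (d₁ : ℚ)) C₂ (ringClassField K ι m)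
          ((VariableChange.pointEquiv (((D • E').quadraticTwist (d₁ : ℚ)).baseChange (ringClassField K ι m)) (untwistAt (hϑ0 m hm))).symm
            ((Affine.Point.congrEquiv (untwistAt_smul_eq (D • E') (hϑ2 m hm) (hϑ0 m hm))).symm
              (VariableChange.pointEquivBaseChange E' D (ringClassField K ι m) (yE m))))) else 0, fun _ => rfl⟩
  have hY : ∀ m (hm : m ≠ 0), Y m = (VariableChange.pointEquivBaseChange ((D • E').quadraticTwist (d₁ : ℚ)) C₂ (ringClassField K ι m)
          ((VariableChange.pointEquiv (((D • E').quadraticTwist (d₁ : ℚ)).baseChange (ringClassField K ι m)) (untwistAt (hϑ0 m hm))).symm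
            ((Affine.Point.congrEquiv (untwistAt_smul_eq (D • E') (hϑ2 m hm) (hϑ0 m hm))).symm
              (VariableChange.pointEquivBaseChange E' D (ringClassField K ι m) (yE m))))) := fun m hm => by
    rw [hYdef m, dif_pos hm]
  -- §5 level bookkeeping from the UNGUARDED level condition (every prime factor inert and prime to `N_W`)
  have hlev : ∀ {m : ℕ}, Squarefree m →
      (∀ q ∈ m.primeFactors, ¬ q ∣ N' ∧ (Ideal.span {(q : 𝓞 K)}).IsPrime) →
      m.Coprime (E'.conductorNorm ℤ) ∧ d₁.gcd m = 1 ∧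
      ∀ ℓ ∈ m.primeFactors, ℓ ≠ 2 ∧ (Ideal.span {(ℓ : 𝓞 K)}).IsPrime ∧ ¬ (ℓ : ℤ) ∣ d₁ ∧
        ¬ ℓ ∣ (C₂ • (D • E').quadraticTwist (d₁ : ℚ)).conductorNorm ℤ := by
    intro m hm hgd
    have hm0 : m ≠ 0 := hm.ne_zero
    have hfacts : ∀ ℓ ∈ m.primeFactors, ℓ ≠ 2 ∧ (Ideal.span {(ℓ : 𝓞 K)}).IsPrime ∧ ¬ (ℓ : ℤ) ∣ d₁ ∧
        ¬ ℓ ∣ (C₂ • (D • E').quadraticTwist (d₁ : ℚ)).conductorNorm ℤ := by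
      intro ℓ hℓ
      have hℓp : ℓ.Prime := Nat.prime_of_mem_primeFactors hℓ
      obtain ⟨hℓN', hinert⟩ := hgd ℓ hℓ
      have hℓW : ¬ ℓ ∣ (C₂ • (D • E').quadraticTwist (d₁ : ℚ)).conductorNorm ℤ := fun h => hℓN' (h.trans hN')
      have hℓ2 : ℓ ≠ 2 := h2' ℓ hℓp hinert hℓN'
      exact ⟨hℓ2, hinert, fun h => not_dvd_discr_of_isPrime_span hK.1 hℓp hℓ2 hinert (h.trans hd₁), hℓW⟩
    refine ⟨?_, ?_, hfacts⟩
    · refine (ModularAuxNorm.coprime_of_forall_primeFactors_not_dvd hm0 fun r hr hrN => ?_).symm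
      obtain ⟨hr2, -, hrd, hrW⟩ := hfacts r hr
      haveI : Fact r.Prime := ⟨Nat.prime_of_mem_primeFactors hr⟩
      have hgoodW : (C₂ • (D • E').quadraticTwist (d₁ : ℚ)).HasGoodReductionAtPrime r :=
        not_not.mp (mt ((C₂ • (D • E').quadraticTwist (d₁ : ℚ)).dvd_conductorNorm_iff_not_hasGoodReductionAtPrime r).mpr hrW)
      have hgoodE := hasGoodReductionAtPrime_of_twist_presentation (C₂ • (D • E').quadraticTwist (d₁ : ℚ)) E' hE' hr2 hrd hgoodW
      exact (E'.dvd_conductorNorm_iff_not_hasGoodReductionAtPrime r).mp hrN hgoodE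
    · have hc : Nat.Coprime d₁.natAbs m :=
        ModularAuxNorm.coprime_of_forall_primeFactors_not_dvd (N := d₁.natAbs) hm0 fun r hr hrd =>
          (hfacts r hr).2.2.1 (Int.ofNat_dvd_left.mpr hrd)
      exact hc
  -- §6 label (B3) at every level `m ≠ 0`
  have hB3all : ∀ (m : ℕ), m ≠ 0 → ∀ τm : ringClassField K ι m ≃ₐ[ℚ] ringClassField K ι m,
      (∀ x : ringClassField K ι m, ((τm x : ringClassField K ι m) : ℂ) = conj (x : ℂ)) →
      ∃ σ' ∈ ringClassGal ι m, IsOfFinAddOrder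
        (pointGalHom (C₂ • (D • E').quadraticTwist (d₁ : ℚ)) (ringClassField K ι m) τm (Y m) - ε • pointGalHom (C₂ • (D • E').quadraticTwist (d₁ : ℚ)) (ringClassField K ι m) σ' (Y m)) := by
    intro m hm0 τm hτm
    by_cases hgood : m ≠ 0 ∧ m.Coprime (E'.conductorNorm ℤ)
    · obtain ⟨σ', hσ', hpin, hfin⟩ := H53 m hm0 hgood.2 (yE m) (hyE m hm0 hgood.2) τm hτm
      refine ⟨σ', hσ', ?_⟩
      rw [hY m hm0]
      exact label_B3_level ι E' D C₂ d₁ (hϑ2 m hm0) (hϑ0 m hm0) huτ hu₁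
        (apply_root_eq_of_conj ι hθ2 hθ0 (hϑC m hm0) τm hτm)
        (apply_root_eq_of_pinned ι (hϑC m hm0) hpin hσ₁θ) hfin
    · refine ⟨1, one_mem _, ?_⟩
      rw [hY m hm0, hyE0 m hgood]
      simp only [map_zero, smul_zero, sub_zero]
      exact IsOfFinAddOrder.zero
  -- §7 label (B2)
  have hyE1 : yE 1 = y := by
    apply Affine.Point.map_injective (f := (ringClassField K ι 1).subtype.toRatAlgHom)
    rw [hyE 1 one_ne_zero (Nat.coprime_one_left (E'.conductorNorm ℤ)), hy]
  have hϑ1 : ϑ 1 one_ne_zero = θ := by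
    apply Subtype.ext
    rw [hϑC 1 one_ne_zero]
    have : χ 1 = 1 := by rw [hχdef]; simp [jacobiSym.one_right]
    rw [this]; push_cast; ring
  have hB2 : ∀ T : Finset (ringClassField K ι 1 ≃ₐ[ℚ] ringClassField K ι 1),
      (∀ g, g ∈ T ↔ g ∈ ringClassGal ι 1) →
      Affine.Point.map (algebraMap K (ringClassField K ι 1)).toRatAlgHom P =
        ∑ g ∈ T, pointGalHom (C₂ • (D • E').quadraticTwist (d₁ : ℚ)) (ringClassField K ι 1) g (Y 1) := by
    intro T hT
    rw [hY 1 one_ne_zero, hyE1, twist_congr E' D C₂ d₁ (hϑ2 1 one_ne_zero) (hϑ0 1 one_ne_zero) hθ2 hθ0 hϑ1,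
      hP, Finset.sum_subtype T hT (fun g => pointGalHom (C₂ • (D • E').quadraticTwist (d₁ : ℚ)) (ringClassField K ι 1) g (VariableChange.pointEquivBaseChange ((D • E').quadraticTwist (d₁ : ℚ)) C₂ (ringClassField K ι 1)
          ((VariableChange.pointEquiv (((D • E').quadraticTwist (d₁ : ℚ)).baseChange (ringClassField K ι 1)) (untwistAt hθ0)).symm
            ((Affine.Point.congrEquiv (untwistAt_smul_eq (D • E') hθ2 hθ0)).symm
              (VariableChange.pointEquivBaseChange E' D (ringClassField K ι 1) y)))))]
    have key := twist_sum_smul_pointGalHom' E' D C₂ (d₁ : ℚ) hθ2 hθ0 (Finset.univ : Finset (ringClassGal ι 1))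
      (fun τ => τ.1) (fun τ => (s τ : ℤ)) (fun τ _ => by
        rcases Int.units_eq_one_or (s τ) with h | h
        · left; rw [h]; rfl
        · right; rw [h]; rfl) (fun τ _ => hθσ τ) y
    exact key
  -- §8 label (B3₀)
  have hB3K := ShimuraKolyvaginConjKLevel.isOfFinAddOrder_map_sub_smul_of_labels hK ι Y hB2 hB3all
  -- §9 labels (B4), (B5) at every UNGUARDED level, and the assembly of `LabelsAt`
  have hB4 : ∀ m : ℕ, Squarefree m →
      (∀ q ∈ m.primeFactors, ¬ q ∣ N' ∧ (Ideal.span {(q : 𝓞 K)}).IsPrime) →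
      ∀ (ℓ : ℕ) (_ : ℓ ∈ m.primeFactors) (hle : ringClassField K ι (m / ℓ) ≤ ringClassField K ι m)
        (σ : ringClassField K ι m ≃ₐ[ℚ] ringClassField K ι m),
        Subgroup.zpowers σ = ringClassGalOver ι m (m / ℓ) →
        letI : Algebra K ℂ := ι.toAlgebra
        ∑ i ∈ Finset.range (ℓ + 1), pointGalHom (C₂ • (D • E').quadraticTwist (d₁ : ℚ)) (ringClassField K ι m) (σ ^ i) (Y m) =
          (C₂ • (D • E').quadraticTwist (d₁ : ℚ)).frobeniusTrace ℓ • WeierstrassCurve.Affine.Point.map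
            (W' := (C₂ • (D • E').quadraticTwist (d₁ : ℚ)))
            ((RingClassField.inclusion ι hle).restrictScalars ℚ) (Y (m / ℓ)) := by
    intro m hm hgd ℓ hℓm hle σ hσ
    obtain ⟨hmN, hgcd, hfacts⟩ := hlev hm hgd
    obtain ⟨hℓ2, hinert, hℓd, hℓW⟩ := hfacts ℓ hℓm
    have hℓ : ℓ.Prime := Nat.prime_of_mem_primeFactors hℓm
    haveI : Fact ℓ.Prime := ⟨hℓ⟩
    have hm0 : m ≠ 0 := hm.ne_zero
    have hℓdvd : ℓ ∣ m := Nat.dvd_of_mem_primeFactors hℓm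
    have hm'0 : m / ℓ ≠ 0 := fun h => hm0 (by
      rw [← Nat.mul_div_cancel' hℓdvd, h, mul_zero])
    have hm'N : (m / ℓ).Coprime (E'.conductorNorm ℤ) := Nat.Coprime.coprime_dvd_left (Nat.div_dvd_of_dvd hℓdvd) hmN
    have hgoodW : (C₂ • (D • E').quadraticTwist (d₁ : ℚ)).HasGoodReductionAtPrime ℓ :=
      not_not.mp (mt ((C₂ • (D • E').quadraticTwist (d₁ : ℚ)).dvd_conductorNorm_iff_not_hasGoodReductionAtPrime ℓ).mpr hℓW)
    have hgoodE := hasGoodReductionAtPrime_of_twist_presentation (C₂ • (D • E').quadraticTwist (d₁ : ℚ)) E' hE' hℓ2 hℓd hgoodW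
    have hϑϑ' : (ϑ m hm0 : ℂ) = (legendreSym ℓ d₁ : ℂ) * (ϑ (m / ℓ) hm'0 : ℂ) := by
      rw [hϑC m hm0, hϑC (m / ℓ) hm'0, ← mul_assoc]
      congr 1
      rw [hχdef m, hχdef (m / ℓ)]
      exact_mod_cast levelSign_eq_legendreSym_mul hℓdvd hm0 hgcd
    rw [hY m hm0, hY (m / ℓ) hm'0]
    exact label_B4_level hK ι hD4 E' D C₂ d₁ Dt hβ hm hℓm hℓ2 hinert hℓd hgoodW hgoodE hmN hle σ hσ
      (hϑ2 m hm0) (hϑ0 m hm0) (hϑ2 (m / ℓ) hm'0) (hϑ0 (m / ℓ) hm'0) hϑϑ' (hyE m hm0 hmN)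
      (hyE (m / ℓ) hm'0 hm'N)
  have hB5 : ∀ m : ℕ, Squarefree m →
      (∀ q ∈ m.primeFactors, ¬ q ∣ N' ∧ (Ideal.span {(q : 𝓞 K)}).IsPrime) →
      ∀ (ℓ : ℕ) (_ : ℓ ∈ m.primeFactors) [Fact ℓ.Prime]
        (hΔ : ¬ (ℓ : ℤ) ∣ minimalDiscriminantInt (C₂ • (D • E').quadraticTwist (d₁ : ℚ)))
        (φ₀ : absoluteGaloisGroup (ZMod ℓ)), (∀ x : AlgebraicClosure (ZMod ℓ), φ₀ • x = x ^ ℓ) →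
      ∀ (hle : ringClassField K ι (m / ℓ) ≤ ringClassField K ι m)
        (emb : ringClassField K ι m →+* AlgebraicClosure K),
        (∀ x : K, emb (algebraMap K (ringClassField K ι m) x) = algebraMap K (AlgebraicClosure K) x) →
      ∀ (j : ((C₂ • (D • E').quadraticTwist (d₁ : ℚ)).baseChange (ringClassField K ι m)).toAffine.Point →+
          geomPoints ((C₂ • (D • E').quadraticTwist (d₁ : ℚ)).baseChange K)),
        j = WeierstrassCurve.Affine.Point.map (W' := (C₂ • (D • E').quadraticTwist (d₁ : ℚ))) emb.toRatAlgHom →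
      ∀ γ : ringClassField K ι m ≃ₐ[ℚ] ringClassField K ι m, γ ∈ ringClassGal ι m →
        letI : Algebra K ℂ := ι.toAlgebra
        geomReduction hΔ ((RatClosure.pointsEquiv (K := K) (C₂ • (D • E').quadraticTwist (d₁ : ℚ))).symm
            (j (pointGalHom (C₂ • (D • E').quadraticTwist (d₁ : ℚ)) (ringClassField K ι m) γ (Y m)))) =
          φ₀ • geomReduction hΔ ((RatClosure.pointsEquiv (K := K) (C₂ • (D • E').quadraticTwist (d₁ : ℚ))).symm
            (j (pointGalHom (C₂ • (D • E').quadraticTwist (d₁ : ℚ)) (ringClassField K ι m) γ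
              (WeierstrassCurve.Affine.Point.map (W' := (C₂ • (D • E').quadraticTwist (d₁ : ℚ)))
                ((RingClassField.inclusion ι hle).restrictScalars ℚ) (Y (m / ℓ)))))) := by
    intro m hm hgd ℓ hℓm _ hΔ φ₀ hφ₀ hle emb hemb j hj γ _
    obtain ⟨hmN, hgcd, hfacts⟩ := hlev hm hgd
    obtain ⟨hℓ2, hinert, hℓd, hℓW⟩ := hfacts ℓ hℓm
    have hℓ : ℓ.Prime := Nat.prime_of_mem_primeFactors hℓm
    have hm0 : m ≠ 0 := hm.ne_zero
    have hℓdvd : ℓ ∣ m := Nat.dvd_of_mem_primeFactors hℓm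
    have hm'0 : m / ℓ ≠ 0 := fun h => hm0 (by
      rw [← Nat.mul_div_cancel' hℓdvd, h, mul_zero])
    have hm'N : (m / ℓ).Coprime (E'.conductorNorm ℤ) := Nat.Coprime.coprime_dvd_left (Nat.div_dvd_of_dvd hℓdvd) hmN
    have hgoodW : (C₂ • (D • E').quadraticTwist (d₁ : ℚ)).HasGoodReductionAtPrime ℓ :=
      not_not.mp (mt ((C₂ • (D • E').quadraticTwist (d₁ : ℚ)).dvd_conductorNorm_iff_not_hasGoodReductionAtPrime ℓ).mpr hℓW)
    have hgoodE := hasGoodReductionAtPrime_of_twist_presentation (C₂ • (D • E').quadraticTwist (d₁ : ℚ)) E' hE' hℓ2 hℓd hgoodW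
    have hϑϑ' : (ϑ m hm0 : ℂ) = (legendreSym ℓ d₁ : ℂ) * (ϑ (m / ℓ) hm'0 : ℂ) := by
      rw [hϑC m hm0, hϑC (m / ℓ) hm'0, ← mul_assoc]
      congr 1
      rw [hχdef m, hχdef (m / ℓ)]
      exact_mod_cast levelSign_eq_legendreSym_mul hℓdvd hm0 hgcd
    rw [hY m hm0, hY (m / ℓ) hm'0]
    exact label_B5_level hNek hK ι E' D C₂ d₁ Dt hβ hm hℓm hℓ2 hinert hℓd hgoodE hmN hΔ hle
      (hϑ2 m hm0) (hϑ0 m hm0) (hϑ2 (m / ℓ) hm'0) (hϑ0 (m / ℓ) hm'0) hϑϑ' (hyE m hm0 hmN)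
      (hyE (m / ℓ) hm'0 hm'N) hφ₀ emb j hj γ
  refine ⟨Y, ε, ⟨hε, hB2, hB3all, hB3K, hB4, hB5⟩, ?_⟩
  -- §10 the identification: a CM point at level `c` transported along ANY root `ϑ'` of `d₁` is `± Y c`
  intro c hc hcN ϑ' hϑ'2 hϑ'0 y' hy'
  have hyc : y' = yE c := by
    apply Affine.Point.map_injective (f := (ringClassField K ι c).subtype.toRatAlgHom)
    rw [hy', hyE c hc hcN]
  rw [hyc, hY c hc]
  exact genusTransport_eq_or_eq_neg E' D C₂ d₁ (hϑ2 c hc) (hϑ0 c hc) hϑ'2 hϑ'0 (yE c)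


/-! ## §2 The labels OFF `2N_W`: no `h2` -/

/-- **THE GENUS FAMILY CARRIES `W`'s OWN LABELS OFF `2N_W`, on every presentation** (`2` inert in `K` or not): the case
`N' = 2N_W` of `genusLabelsAt_of_facts_level` — an inert prime factor of a level prime to `2N_W` is odd, so `h2` is vacuous.
[cite: GrossLMS1991, §3 Prop. 3.7, §5 Prop. 5.3] [cite: Nekovar2007, Prop. 4.9] [cite: Darmon2004, Thm. 3.6] -/
theorem genusLabelsAt_of_facts_odd
    (hG1 : ∀ (N : ℕ) [NeZero N] (W : WeierstrassCurve ℚ) (K : Type) [Field K] [NumberField K],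
      phi_heegnerPointOfConductor_mem_range_map_ringClassField_birch N W K)
    (hNek : Nekovar2007.cmPoint_frobeniusCongruence)
    (hP53 : ∀ (N : ℕ) [NeZero N] (W : WeierstrassCurve ℚ) (K : Type) [Field K] [NumberField K],
      GrossLMS1991.prop53_conj_pinned_birch N W K)
    (hK : IsImaginaryQuadratic K) (hD4 : NumberField.discr K < -4) (ι : K →+* ℂ)
    (E' : WeierstrassCurve ℚ) [E'.IsElliptic] [E'.IsGloballyMinimal] [NeZero (E'.conductorNorm ℤ)]
    (D C₂ : VariableChange ℚ) [(D • E').IsCharNeTwoNF] (d₁ : ℤ)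
    [(C₂ • (D • E').quadraticTwist (d₁ : ℚ)).IsElliptic] [(C₂ • (D • E').quadraticTwist (d₁ : ℚ)).IsGloballyMinimal]
    (hE' : ∃ C : VariableChange ℚ, C • (C₂ • (D • E').quadraticTwist (d₁ : ℚ)).quadraticTwist (d₁ : ℚ) = E')
    (hd₁ : d₁ ∣ NumberField.discr K)
    (Dt : ModularParametrizationData E' (E'.conductorNorm ℤ)) {β : ℤ}
    (hβ : (4 * (E'.conductorNorm ℤ : ℤ)) ∣ β ^ 2 - NumberField.discr K)
    {θ : ringClassField K ι 1} (hθ2 : θ ^ 2 = algebraMap ℚ (ringClassField K ι 1) (d₁ : ℚ)) (hθ0 : θ ≠ 0)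
    (s : ringClassGal ι 1 → ℤˣ)
    (hθσ : ∀ σ : ringClassGal ι 1, σ.1 θ = ((s σ : ℤ) : ringClassField K ι 1) * θ)
    {y : (E'.baseChange (ringClassField K ι 1)).toAffine.Point}
    (hy : Affine.Point.map (ringClassField K ι 1).subtype.toRatAlgHom y =
      heegnerPointComplexOfConductor Dt (NumberField.discr K) β 1)
    {instF : Fintype (ringClassGal ι 1)}
    {P : ((C₂ • (D • E').quadraticTwist (d₁ : ℚ)).baseChange K).toAffine.Point}
    (hP : Affine.Point.map (algebraMap K (ringClassField K ι 1)).toRatAlgHom P =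
      (VariableChange.pointEquivBaseChange ((D • E').quadraticTwist (d₁ : ℚ)) C₂ (ringClassField K ι 1)
          ((VariableChange.pointEquiv (((D • E').quadraticTwist (d₁ : ℚ)).baseChange (ringClassField K ι 1)) (untwistAt hθ0)).symm
            ((Affine.Point.congrEquiv (untwistAt_smul_eq (D • E') hθ2 hθ0)).symm
              (VariableChange.pointEquivBaseChange E' D (ringClassField K ι 1) (∑ τ : ringClassGal ι 1, (s τ : ℤ) • pointGalHom E' (ringClassField K ι 1) τ.1 y)))))) :
    ∃ (ys : (m : ℕ) → ((C₂ • (D • E').quadraticTwist (d₁ : ℚ)).baseChange (ringClassField K ι m)).toAffine.Point) (ε : ℤ),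
      ShimuraWalk.LabelsAt (C₂ • (D • E').quadraticTwist (d₁ : ℚ)) (2 * (C₂ • (D • E').quadraticTwist (d₁ : ℚ)).conductorNorm ℤ)
        K ι P ys ε ∧
      ∀ (c : ℕ) (hc : c ≠ 0), c.Coprime (E'.conductorNorm ℤ) →
        ∀ {ϑ' : ringClassField K ι c} (hϑ'2 : ϑ' ^ 2 = algebraMap ℚ (ringClassField K ι c) (d₁ : ℚ)) (hϑ'0 : ϑ' ≠ 0)
          {y' : (E'.baseChange (ringClassField K ι c)).toAffine.Point},
          Affine.Point.map (ringClassField K ι c).subtype.toRatAlgHom y' =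
            heegnerPointComplexOfConductor Dt (NumberField.discr K) β c →
          VariableChange.pointEquivBaseChange ((D • E').quadraticTwist (d₁ : ℚ)) C₂ (ringClassField K ι c)
              ((VariableChange.pointEquiv (((D • E').quadraticTwist (d₁ : ℚ)).baseChange (ringClassField K ι c)) (untwistAt hϑ'0)).symm
                ((Affine.Point.congrEquiv (untwistAt_smul_eq (D • E') hϑ'2 hϑ'0)).symm
                  (VariableChange.pointEquivBaseChange E' D (ringClassField K ι c) y'))) = ys c ∨
          VariableChange.pointEquivBaseChange ((D • E').quadraticTwist (d₁ : ℚ)) C₂ (ringClassField K ι c)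
              ((VariableChange.pointEquiv (((D • E').quadraticTwist (d₁ : ℚ)).baseChange (ringClassField K ι c)) (untwistAt hϑ'0)).symm
                ((Affine.Point.congrEquiv (untwistAt_smul_eq (D • E') hϑ'2 hϑ'0)).symm
                  (VariableChange.pointEquivBaseChange E' D (ringClassField K ι c) y'))) = - ys c :=
  genusLabelsAt_of_facts_level hG1 hNek hP53 hK hD4 ι E' D C₂ d₁ hE' hd₁ Dt hβ hθ2 hθ0 s hθσ hy hP
    (Dvd.intro_left 2 rfl) fun _ _ _ hℓN h2 ↦ hℓN (h2 ▸ Dvd.intro _ rfl)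

end Summit.BirchSwinnertonDyer.BirchSwinnertonDyer.Theorems.GenusLine

end
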